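import Literature.NumberTheory.Rogawski1990.CohomologicalFinComponentIsTheta
import Literature.NumberTheory.Automorphic.UnitaryGroupPlaceInclusion
import Literature.NumberTheory.Automorphic.Liu2021.Def411WeilCarriersLocalIsotypyAtPlace
import Literature.NumberTheory.Automorphic.Liu2021.Def411WeilCarriersLocalTypesOfEquiv
import Literature.NumberTheory.Automorphic.UnitaryGroupLocalCongr
import Literature.RepresentationTheory.Liu2021.GlobalOscillatorIsomorphismCriterion
import Literature.NumberTheory.GelbartRogawski1991.FiniteAdelicWeilCentralCoinvariantsIsotypic
import Literature.NumberTheory.Automorphic.IrreducibleClassesComap                     -- ★ `IrrClass.comap`, `comap_surjective`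
import Literature.NumberTheory.Rogawski1990.GlobalAPacketLetters                          -- ★ p812883 (typ3 round 2): the named fact S2♭ `cohDiscrete_memXiFamily` (BY NAME)
import Literature.NumberTheory.GelbartRogawski1991.XiEnvelopeNonsplitThetaType         -- ★ D7α (F0-typ3 (g5)): the PRINT letter `xiEnvelope_nonsplit_isThetaType` (BY NAME, v1.2)
import Literature.NumberTheory.GelbartRogawski1991.WeilLiftNonsplitPrincipalSeriesConstituent  -- ★ p818501 U′-N (F0-typ1 (g5)): the PRINT letter `GR91Lemma512NonsplitAsPrinted` (BY NAME, v1.4)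
import Summits.HodgeConjecture.HodgeConjecture.Theorems.F0P2oGR91NOfLetters                   -- ★ p828472 B-p14 (g27): the Lines-free TWIN `GR91N_of_letters (hN3) (hW) (hU1)` of the parent pay-down line's composition (v1.5)
import Summits.HodgeConjecture.HodgeConjecture.Theorems.F0P2oXiLocalPacketThetaPairOfLetters    -- ★ p829745 B-p14 (g27): the Lines-free TWIN `xiLocalPacket_nonsplit_isThetaPair_of_letters` (#75-loc ⟸ N3, K1w, U1, N6, LABEL) (v1.7)
import Summits.HodgeConjecture.HodgeConjecture.Theorems.F0P2oD7alphaMembersThetaClass           -- ★ p830189 B-p14 (g27): `d7alpha_members_thetaClass` (record members are theta types) (v1.7)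
import Summits.HodgeConjecture.HodgeConjecture.Theorems.F0P2oIsoAtXfOfThetaTypeAt                 -- ★ p830228 A-p12 (g17): ISO-BRIDGE `exists_isoAtXfCM_of_forall_mem` (v1.7)
import Literature.NumberTheory.Rogawski1990.CMThetaDockingClauses                                -- ★ the theta-docking clause `CMThetaDockingClauses` (v1.7)
import Literature.NumberTheory.Rogawski1990.U3SupercuspidalJacquetCriterion                      -- ★ p826085 typ-T7a: THE N6 LETTER `u3_isSupercuspidal_iff_jacquet_eq_zero` (BY NAME, v1.7)
import Literature.NumberTheory.Automorphic.U3JacquetVanishingSupercuspidal   -- ★ p831380 A-p16 (g23) over ★ B-p17 (g21) (δ): `u3_isSupercuspidal_iff_jacquet_eq_zero_holds` — THE N6 LETTER PROVED IN-HOUSE (v1.8)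
import Literature.NumberTheory.Rogawski1990.U3SquareIntegrabilityExponentCriterion              -- ★ typ-T7b (g0): THE N7 LETTER `u3_squareIntegrable_jacquetExponent_decay` (row N7; BY NAME, v1.9)
import Summits.HodgeConjecture.HodgeConjecture.Theorems.F0P2pK1wHolds   -- ★ p833012 F0P2-p06 (g2): K1w HYPOTHESIS-FREE `cmPrincipalSeries_isConstituentOf_weylConj_holds` (over ★ p832032 + ★ p832625 N1), BY NAME (v1.11)
import Summits.HodgeConjecture.HodgeConjecture.Theorems.F0P2pGR91NOfN3   -- ★ p833094 F0P2-p06 (g2): `u1ThetaDichotomy_nonsplit_of_N3 (hN3)`, `GR91Lemma512NonsplitAsPrinted_of_N3 (hN3)` (U1 ∕ #76 modulo N3 only), BY NAME (v1.11)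
import Summits.HodgeConjecture.HodgeConjecture.Theorems.F0P2oN3OfTorusWeight   -- ★ p835661 F0P2-p06 (g3): THE N3 PACKAGER `thetaType_nonsplit_jacquetModule_of_a_of_torusWeight (hA) (hD)` over ★ p835430 (b)-assembler `F0P2oN3TorusWeightOfD3d`, BY NAME («N3 SPLIT», edition v1.12)
import Summits.HodgeConjecture.HodgeConjecture.Theorems.F0P2oN3TorusWeightHolds   -- ★ A-p16 (g24) (5c): `forall_jacquetModule_xThetaGqsCM_torus_eq_smul` = the packager՚s (hD) binder PROVED (token for token) ⇒ `stub_N3D_letter` closed BY NAME («N3D FOLD»)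
import Summits.HodgeConjecture.HodgeConjecture.Theorems.F0P2oLineJacquetHolds   -- ★ p839151 F0P2-p06 (g4) (JA): `thetaType_nonsplit_jacquetModule_holds : GelbartRogawski1991.thetaType_nonsplit_jacquetModule` HYPOTHESIS-FREE ⇒ `stub_N3_letter` closed BY NAME («N3 DIRECT FOLD»)
import Summits.HodgeConjecture.HodgeConjecture.Theorems.F0P2oD7alphaMemDockStatement   -- ★ p839951 F0P2-p01 (g9): `StubD7αMemDockPerMeasure` — the D7α node of record PER MEASURE (body pin 88b1609ac8246fc6, ref1 r237∕r238) ⇒ `stub_D7αMemDockμ` BY NAME («D7α RE-CUT BY NAME»)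
import Summits.HodgeConjecture.HodgeConjecture.Theorems.F0P2oD7alphaMembersThetaClassTest   -- ★ p840385 F0P2-p06 (g5): packet-level glueᵀ `d7alpha_packet_members_thetaClassTest` (Test-(13.1.4) completion ⇒ members are CM theta types)
import Summits.HodgeConjecture.HodgeConjecture.Theorems.F0P2oN7OfCasselmanCriterion   -- ★ p835805 A-p13 (g27): Casselman՚s criterion ⇒ for the quasi-split `U(3)` at a non-split place over #109 N5 ★ p834912 — `u3_squareIntegrable_jacquetExponent_decay_holds`, HYPOTHESIS-FREE ⇒ `stub_N7_letter` closed BY NAME («N7 FOLD»; books #110 −1 at this REGISTERED edition)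
import Summits.HodgeConjecture.HodgeConjecture.Theorems.F0P2oThetaTypeNotL2   -- ★ p831648 B-p18 (g28): LABEL `thetaType_not_squareIntegrable (hN3) (hN6) (hN7)` (Lines-free Theorems file, BY NAME, v1.9)
import Literature.NumberTheory.GelbartRogawski1991.ThetaTypeNonsplitJacquetModule          -- ★ p826177 typ-T7a (g0): THE N3 LETTER `thetaType_nonsplit_jacquetModule` (BY NAME, v1.5)
import Literature.NumberTheory.Rogawski1990.U3PrincipalSeriesWeylConjugate                -- ★ p826332 typ-T7a (g0): THE K1w LETTER `cmPrincipalSeries_isConstituentOf_weylConj` (BY NAME, v1.5)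
import Literature.NumberTheory.GelbartRogawski1991.U1ThetaDichotomy                        -- ★ p826953∕p827180 typ-T7b (g0): THE U1 LETTER `u1ThetaDichotomy_nonsplit` (BY NAME, v1.5)
import Summits.HodgeConjecture.HodgeConjecture.Theorems.F0P2iGRDWitness                      -- p819322 (F0P2-p01 (g5)): DICT-CHOICE witness `grdMu`, `grdChi` + pins (v1.4)
import Summits.HodgeConjecture.HodgeConjecture.Theorems.F0P2iGRDAssembly                     -- A-p17 (g15): pinned GRD core `grdMatrix_grdMu_grdChi_of_GR91N` (v1.4)
import Summits.HodgeConjecture.HodgeConjecture.Theorems.F0P2iRIGinfDischarge                 -- ★ p819114 (B-p18 (g26)): `rigInf_node_of_xiArchPinned` over ★ `XiArchPinned` p818382 + ★ `stubRIGinfArith_holds` p818525 (v1.4)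
import Summits.HodgeConjecture.HodgeConjecture.Theorems.F0P3CompactTrivOfRecord                 -- ★ p819716 (F0P3): `cmCompactFactor_rightRegular_eq_self_of_isHolOrAntihol` (C2♯'s `Kc`-binder, v1.4)
import Literature.RepresentationTheory.HarrisKudlaSweet1996.SplittingCharactersCM                   -- ★ `IsSplittingChar.exists_hasUnitaryArchType` (μω's odd unitary arch type, v1.4)
import Literature.NumberTheory.Rogawski1990.CohDiscreteMemXiFamilyArchPinned             -- ★ S2♯ (F0-typ3 (g6), DEF lane): the print-derived letter `cohDiscrete_memXiFamily_archPinned` (BY NAME, v1.4b)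
import Summits.HodgeConjecture.CorCM.B01.Transposition.Item6OmegaChiSplitting           -- `OmegaChiSplitting.chiLocalSplittingsD` (★ B01)
import Summits.HodgeConjecture.HodgeConjecture.Theorems.F0P2cOmegaLocalType              -- ★ p803803 F0P2-p01 (g3): CE-L `formCongr_frame`
import Summits.HodgeConjecture.HodgeConjecture.Theorems.F0P3MemXiFamilyTransfer          -- ★ F0P3-p04 (g5): `exists_muOmega`; imports ★ T♭-core `smoothConstituents_iff_of_hasFinComponent`
import Summits.HodgeConjecture.HodgeConjecture.Theorems.F0P3SLayerFoldShapes             -- ★ F0P3-p03 (g5): token producer `exists_cohToken_of_isHolOrAntihol_cpt`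
import Summits.HodgeConjecture.HodgeConjecture.Theorems.F0P2cStubCLLocalTypeExists       -- ★ CL (rung 2, CE side): LOCAL TYPES EXIST `stubCL_holds` (Flath) — LTY-τ BY NAME
import Summits.HodgeConjecture.HodgeConjecture.Theorems.F0P2hLTYLocalConstituents        -- ★ p816375 (F0P2-p01 (g5)): LTY-c `exists_member_isConstituentOf_localType` — LTY BY NAME
import Summits.HodgeConjecture.HodgeConjecture.Theorems.F0P2iVocabularyBridge          -- ★ p818933: `isoAtXf_iff_CM`, `thetaTypeAt_iff_CM` (`Iff.rfl` bridges to the CM vocabulary)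
import HarnessLib

/-!
# T-PKΠ — `PKΠ ⟸ {#80 S2♯, D7αᵀ}` as a hypothesis-form THEOREM over the two remaining P3-side TOKENS, BY NAME (Lines-free twin of PKΠ v1.15)

Programme P2 (theta ∕ `hdictE`), cell hodgecm-mathlib, floor 0; crux H413 = stmt-HodgeConjecture-24833; socket 27455 `F0HdictE`.
Desk F0P2-plan (g14), REPORT-FIRST candidate bytes (PLAN-P2 v16 §3 BRIEF 2); a pen files it (`--supports stmt-HodgeConjecture-24833 --as helper`).

`pkPi_of_tokens (h80 : Rogawski1990.cohDiscrete_memXiFamily_archPinned) (hD7αT : F0P2oD7alphaMemDockStatement.StubD7αMemDockPerMeasureT) : ‹PKPiTarget›`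
— the conclusion is the PKΠ text VERBATIM (`Lines/F0_P2PKPiRung4.lean` v1.15 1c411f575d01a948 :273–:313, = `F0P2PKRung3.StubPKPiPlacewiseMembership`
= the `hPKPi` binder of ★ `F0P2kHdictEOfLetters.hdictE_of_PKPi_E3flat`, ws-sha16 85668f9d716ab76d); the proof is PKΠ v1.15's head `pkPi_of_rung4` with
(i) S2♯-export inlined over the token `h80` (= `s2SharpExport_of_C2sharp`: ★ `exists_cohToken_of_isHolOrAntihol_cpt`, ★ p819716, ★ `IsSplittingChar.exists_hasUnitaryArchType`),
(ii) GR91N ★ BY NAME `F0P2pGR91NOfN3.GR91Lemma512NonsplitAsPrinted_of_N3` over ★ N3 `F0P2oLineJacquetHolds.thetaType_nonsplit_jacquetModule_holds`,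
(iii) RIGf (dictionary form) inlined over the token `hD7αT` (= `stub_RIGfDict`: ★ ISO-BRIDGE `exists_isoAtXfCM_of_forall_mem` p830228 over ★ packet-level Test glue
`d7alpha_packet_members_thetaClassTest` p840385 and ★ #75-loc twin `xiLocalPacket_nonsplit_isThetaPair_of_letters` p829745 fed by ★ N3 ∕ ★ K1w p833012 ∕ ★ U1 p833094 ∕ ★ N6 p831380 ∕
★ LABEL p831648 (over ★ N7 p835805)), (iv) the `Iff.rfl` vocabulary bridges ★ p818933 in place of the Lines-local `IsoAtXf` ∕ `ThetaTypeAt` ∕ `GRDMatrix`.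
No Lines import; THEOREMS ONLY (no `def`, no `instance`, no attribute, no notation, no `sorry`).  Template: ★ `F0P2jPKPiOfLetters.pkPi_of_letters` (A-p17 (g15), v1.5 road).

Day X use (PLAN-P2 v16 §3 FAST PATH): `F0HdictE_holds := F0P2kHdictEOfLetters.hdictE_of_PKPi_E3flat (pkPi_of_tokens s2sharp80_holds d7αT_holds) (F0P2vE3FlatOfRelOne.e3flat_of_relOne
(F0P2vRelOneOfRelSharpOne.relOne_of_relSharpOne relSharpOne_holds))`.  HC_CM is proved only modulo the printed citations until rung 0 closes.

References: [Rogawski1990] J. Rogawski, Ann. of Math. Stud. 123 (1990): Thm. 13.3.6 (c), §13.1 p. 199, Prop. 15.2.1 (b); [GelbartRogawski1991] Invent. Math. 105 (1991): Lem. 5.1.2 p. 466;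
[Liu2021] Y. Liu, Camb. J. Math. 9 (2021) = arXiv:2102.11518: Def. 4.11, Remark 4.2; [HarrisKudlaSweet1996] J. AMS 9 (1996): Cor. 4.4.
-/

set_option autoImplicit false
set_option linter.dupNamespace false

noncomputable section

open NumberField MeasureTheory IsDedekindDomain
open scoped Matrix ComplexOrder

namespace Summit.HodgeConjecture.HodgeConjecture.Cruxes.H413.F0P2vPKPiOfTokens

open Literature.NumberTheory Literature.NumberTheory.Automorphic Literature.NumberTheory.Automorphic.UnitaryGroup
open Literature.NumberTheory.Automorphic.UnitaryGroup.CotangentForms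
open Literature.NumberTheory.Automorphic.IdeleClassGroup
open Literature.NumberTheory.Automorphic.Liu2021 Literature.NumberTheory.Automorphic.Liu2021.Def411WeilCarriers
open Literature.NumberTheory.Automorphic.Liu2021.Def411WeilCarriersDoubling
open Literature.NumberTheory.GelbartRogawski1991 Literature.NumberTheory.GelbartRogawski1991.UnitaryDualPair
open Literature.NumberTheory.GelbartRogawski1991.UnitaryDualPair.WeilCoinv
open Literature.RepresentationTheory Literature.RepresentationTheory.Liu2021
open Literature.NumberTheory.GaloisRepresentations
open Literature.NumberTheory.Rogawski1990
open Summit.HodgeConjecture.CorCM.Transposition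
open Summit.HodgeConjecture.HodgeConjecture.Cruxes.H413.F0P3MemXiFamilyTransfer
open Summit.HodgeConjecture.HodgeConjecture.Cruxes.H413.F0P3SLayerFoldShapes
open Summit.HodgeConjecture.HodgeConjecture.Cruxes.H413.F0P2cStubCLLocalTypeExists
open Summit.HodgeConjecture.HodgeConjecture.Cruxes.H413.F0P2hLTYLocalConstituents
open Literature.RepresentationTheory.KonnoKonno2007 Literature.RepresentationTheory.BorelWallach2000   -- v1.4: `uFormGroup`, `upqTypeClasses` in `C2SharpLetter`
open Summit.HodgeConjecture.HodgeConjecture.Cruxes.H413.F0P2oIsoAtXfOfThetaTypeAt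

set_option synthInstance.maxHeartbeats 400000 in
set_option maxHeartbeats 16000000 in
/-- **PKΠ ⟸ #80 S2♯ + D7αᵀ** (GR91N, N3, K1w, U1, N6, N7, LABEL, #75-loc, ISO-BRIDGE, GRD, RIG∞, CL, LTY-c all ★ by name; no `sorry`).
[cite: Rogawski1990, Thm. 13.3.6 (c), §13.1 p. 199, Prop. 15.2.1 (b)] [cite: GelbartRogawski1991, Lem 5.1.2 p. 466] -/
theorem pkPi_of_tokens (h80 : Literature.NumberTheory.Rogawski1990.cohDiscrete_memXiFamily_archPinned)
    (hD7αT : Summit.HodgeConjecture.HodgeConjecture.Cruxes.H413.F0P2oD7alphaMemDockStatement.StubD7αMemDockPerMeasureT) :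
  ∀ (L : Type) [Field L] [NumberField L] [IsCMField L] (ι : L →+* ℂ) (H : Matrix (Fin 3) (Fin 3) L) (T : GL (Fin 3) ℂ)
    (hT : (T : Matrix (Fin 3) (Fin 3) ℂ)ᴴ * H.map ι * (T : Matrix (Fin 3) (Fin 3) ℂ) = Literature.Geometry.ComplexHyperbolic.BallModel.J),
    (∀ τ' : L →+* ℂ, InfinitePlace.mk τ' ≠ InfinitePlace.mk ι → (H.map τ').PosDef) → 2 ≤ Module.finrank ℚ ↥(maximalRealSubfield L) →
    ∀ {n' : ℕ} (e₁ : Fin 3 × Fin 1 ≃ Fin n') (dV : Fin 3 → L) (hdV : ∀ i, IsCMField.complexConj L (dV i) = dV i)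
      (hdV0 : ∀ i, dV i ≠ 0) (g : GL (Fin 3) L)
      (hg : ((g : Matrix (Fin 3) (Fin 3) L).map (cmConjRingHom L))ᵀ * H * (g : Matrix (Fin 3) (Fin 3) L) = Matrix.diagonal dV)
      (ιV : finAdelic (↥(maximalRealSubfield L)) L (IsCMField.complexConj L) 3 H →*
          finAdelic (↥(maximalRealSubfield L)) L (IsCMField.complexConj L) 3 (Matrix.diagonal dV)),
        (∀ k, ((ιV k : finAdelic (↥(maximalRealSubfield L)) L (IsCMField.complexConj L) 3 (Matrix.diagonal dV)) :
            GL (Fin 3) (FiniteAdeleRing (𝓞 L) L)) =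
          (toFinAdeleGL L 3 g)⁻¹ * (k : GL (Fin 3) (FiniteAdeleRing (𝓞 L) L)) * toFinAdeleGL L 3 g) →
        ∀ (μ : Measure (adelicGroupData (↥(maximalRealSubfield L)) L (IsCMField.complexConj L) 3 H).automorphicQuotient)
          [(adelicGroupData (↥(maximalRealSubfield L)) L (IsCMField.complexConj L) 3 H).IsAutomorphicMeasure μ]
          (W : Type) [AddCommGroup W] [Module ℂ W]
          (σ : Representation ℂ (finAdelic (↥(maximalRealSubfield L)) L (IsCMField.complexConj L) 3 H) W),
          σ.IsIrreducible → σ.IsSmooth → σ.IsAdmissible →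
          ∀ P : DiscreteAutomorphicRep (adelicGroupData (↥(maximalRealSubfield L)) L (IsCMField.complexConj L) 3 H) μ,
            (P.IsHolCotangentAt (cmArchSection L ι H T hT) (cmCompactFactor L ι H T hT) ∨
              P.IsAntiholCotangentAt (cmArchSection L ι H T hT) (cmCompactFactor L ι H T hT)) →
            P.HasFinComponent σ →
            ∃ (μ : Literature.NumberTheory.Automorphic.IdeleClassGroup L →ₜ* Circle) (hμ : IsConjugateSymplectic L μ), HasWeight L μ 1 ∧
              ∃ (χ : Chi (↥(maximalRealSubfield L)) L (IsCMField.complexConj L)),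
                ∀ (v : HeightOneSpectrum (𝓞 ↥(maximalRealSubfield L))), ∃ εv : (↥(maximalRealSubfield L))ˣ,
                    isotypicComponent (MonoidAlgebra ℂ (localPi L (IsCMField.complexConj L) 3 H v))
                      (Representation.asModule (σ.comp (inclPlace (↥(maximalRealSubfield L)) L (IsCMField.complexConj L) 3 H v)))
                      (Representation.asModule
                        (((show Representation ℂ (localPi L (IsCMField.complexConj L) 3 (Matrix.diagonal dV) v) _ from
                          (TwistedCoinv.rep (localCharOfCenter (↥(maximalRealSubfield L)) L (IsCMField.complexConj L)
                              (JW (↥(maximalRealSubfield L)) L εv) (JW_apply_ne_zero (↥(maximalRealSubfield L)) L εv) χ.1 v)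
                            ((OmegaChiSplitting.chiLocalSplittingsD ⟨L⟩ e₁ dV hdV hdV0 (toHeckeCharacter L μ)
                              ((isOscillatorChar_toHeckeCharacter_iff μ).mpr hμ) εv).omegaLoc v)
                            (commute_omegaLoc_localCenter (↥(maximalRealSubfield L)) L (IsCMField.complexConj L) 3 e₁ (Matrix.diagonal dV)
                              (JW (↥(maximalRealSubfield L)) L εv) (complexConj_imagUnit L) (imagUnit_ne_zero L) (imagUnit_mul_self L)
                              (realDiagonal_isSymm L dV hdV) (isSymm_TW (↥(maximalRealSubfield L)) εv) (realDiagonal_map L dV hdV).symm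
                              (JW_eq (↥(maximalRealSubfield L)) L εv) (JW_apply_ne_zero (↥(maximalRealSubfield L)) L εv)
                              (OmegaChiSplitting.chiLocalSplittingsD ⟨L⟩ e₁ dV hdV hdV0 (toHeckeCharacter L μ)
                                ((isOscillatorChar_toHeckeCharacter_iff μ).mpr hμ) εv) v)).comp
                            (UnitaryGroup.localLineInl L (IsCMField.complexConj L) 3 e₁ (Matrix.diagonal dV) (JW (↥(maximalRealSubfield L)) L εv) v)) :
                            localPi L (IsCMField.complexConj L) 3 (Matrix.diagonal dV) v →* _).comp
                          (localCongr L (IsCMField.complexConj L) g one_ne_zero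
                            (F0P2cOmegaLocalType.formCongr_frame L H dV g hg) v).symm.toMulEquiv.toMonoidHom)) = ⊤ := by
  intro L _ _ _ ι H T hT hdef h2 n' e₁ dV hdV hdV0 g hg ιV hιV μ _ W _ _ σ hirr hsm hadm P hP hfin
  -- the print letters, ★ closed by name (PKΠ v1.15 §2): N3, GR91N ⟸ N3, #75-loc ⟸ {N3, K1w, U1 ⟸ N3, N6, LABEL ⟸ {N3, N6, N7}}
  have hN3 : Literature.NumberTheory.GelbartRogawski1991.thetaType_nonsplit_jacquetModule :=
    Summit.HodgeConjecture.HodgeConjecture.Cruxes.H413.F0P2oLineJacquetHolds.thetaType_nonsplit_jacquetModule_holds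
  have hN6 : Literature.NumberTheory.Rogawski1990.u3_isSupercuspidal_iff_jacquet_eq_zero :=
    Literature.NumberTheory.Rogawski1990.u3_isSupercuspidal_iff_jacquet_eq_zero_holds
  have hGR : Literature.NumberTheory.GelbartRogawski1991.GR91Lemma512NonsplitAsPrinted :=
    Summit.HodgeConjecture.HodgeConjecture.Cruxes.H413.F0P2pGR91NOfN3.GR91Lemma512NonsplitAsPrinted_of_N3 hN3
  have h75 : Literature.NumberTheory.GelbartRogawski1991.xiLocalPacket_nonsplit_isThetaPair :=
    Summit.HodgeConjecture.HodgeConjecture.Cruxes.H413.F0P2oXiLocalPacketThetaPairOfLetters.xiLocalPacket_nonsplit_isThetaPair_of_letters hN3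
      Summit.HodgeConjecture.HodgeConjecture.Cruxes.H413.F0P2pK1wHolds.cmPrincipalSeries_isConstituentOf_weylConj_holds
      (Summit.HodgeConjecture.HodgeConjecture.Cruxes.H413.F0P2pGR91NOfN3.u1ThetaDichotomy_nonsplit_of_N3 hN3) hN6
      (Summit.HodgeConjecture.HodgeConjecture.Cruxes.H413.F0P2oThetaTypeNotL2.thetaType_not_squareIntegrable hN3 hN6
        Summit.HodgeConjecture.HodgeConjecture.Cruxes.H413.F0P2oN7OfCasselmanCriterion.u3_squareIntegrable_jacquetExponent_decay_holds)
  obtain ⟨μω, hμu, hquad⟩ := exists_muOmega L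
  -- S2♯-export inlined over the token #80 (PKΠ v1.15 `s2SharpExport_of_C2sharp`)
  obtain ⟨M, iM₁, iM₂, σK, σ𝔤, hM, δ, hδ, hirrGK, hT₁, hne⟩ := exists_cohToken_of_isHolOrAntihol_cpt L ι H T hT μ hdef h2 P hP
  have hKc := F0P3CompactTrivOfRecord.cmCompactFactor_rightRegular_eq_self_of_isHolOrAntihol L ι H T hT P hP
  obtain ⟨ξ, hmem, hall⟩ := @h80 L _ _ _ ι H T hT hdef h2 μ _ μω hμu hquad P hP hKc M iM₁ iM₂ σK σ𝔤 hM hirrGK hT₁ δ hδ hne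
  have hsχ : HarrisKudlaSweet1996.IsSplittingChar L 1 μω := (HarrisKudlaSweet1996.isSplittingChar_iff_of_odd odd_one μω).2 hquad
  obtain ⟨k, hk, hmod⟩ := hsχ.exists_hasUnitaryArchType hμu
  have hodd : ∀ w : InfinitePlace L, Odd (k w) := fun w => Int.odd_iff.2 (by simpa [Int.ModEq] using hmod w)
  have hpin : XiArchPinned L ξ μω k := ⟨hk, hodd, hall k hk⟩
  -- the DICT-CHOICE witness (μ_ξ, χ_f) and its pins (★ p819322)
  have hμ1 : IsConjugateSymplectic L (F0P2iGRDWitness.grdMu L ξ μω hμu) :=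
    F0P2iGRDWitness.isConjugateSymplectic_grdMu L ξ μω hμu hquad
  have hcont : Continuous (F0P2iGRDWitness.grdChi L ξ μω hquad) := F0P2iGRDWitness.continuous_grdChi L ξ μω hquad
  have hunit : ∀ z, ‖((F0P2iGRDWitness.grdChi L ξ μω hquad z : ℂˣ) : ℂ)‖ = 1 := F0P2iGRDWitness.norm_grdChi_apply L ξ hμu hquad
  -- the finite Gelbart–Rogawski dictionary at the witness, from GR91N (★ A-p17 pinned core; `GRDMatrixCM` currency)
  have hm := F0P2iGRDAssembly.grdMatrix_grdMu_grdChi_of_GR91N hGR L H (transpose_map_cmConjRingHom_eq_of_frame L ι H T hT)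
    (isUnit_det_of_frame L ι H T hT) e₁ dV hdV hdV0 g hg ξ μω hμu hquad
  -- RIG∞: weight one of `μ_ξ` and automorphy of `χ_f` (★ p819114)
  obtain ⟨hw, haut⟩ := F0P2iRIGinfDischarge.rigInf_node_of_xiArchPinned L ξ μω k hpin (F0P2iGRDWitness.grdMu L ξ μω hμu)
    (F0P2iGRDWitness.toHeckeCharacter_grdMu L ξ μω hμu) (F0P2iGRDWitness.grdChi L ξ μω hquad)
    (F0P2iGRDWitness.grdChi_finAdelicCheck L ξ μω hquad (complexConj_mul_complexConj' L))
  refine ⟨F0P2iGRDWitness.grdMu L ξ μω hμu, hμ1, hw, ⟨F0P2iGRDWitness.grdChi L ξ μω hquad, haut⟩, fun v => ?_⟩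
  by_cases hs : ∃ w : PlacesOver L v, IsCMField.complexConj L • w.1 ≠ w.1
  · -- SPLIT place: LTY BY NAME (★ CL `stubCL_holds` + ★ LTY-c p816375) + (S) at the witness
    obtain ⟨T₀, iT₁, iT₂, τ, hτ, htop⟩ :=
      stubCL_holds (↥(maximalRealSubfield L)) L (IsCMField.complexConj L) 3 H W σ hirr hadm v
    obtain ⟨Pv, hfam, hmemτ⟩ := exists_member_isConstituentOf_localType P hirr hsm hfin hmem
    obtain ⟨c, hc, hconst⟩ := hmemτ v T₀ τ hτ htop
    obtain ⟨ε, hΘ⟩ := hm.1 Pv hfam v hs c hc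
    exact ⟨ε, (F0P2iVocabularyBridge.thetaTypeAt_iff_CM L H e₁ dV hdV hdV0 g hg (F0P2iGRDWitness.grdMu L ξ μω hμu) hμ1
      (F0P2iGRDWitness.grdChi L ξ μω hquad) ε v c).mpr hΘ T₀ τ hτ hconst W
        (σ.comp (inclPlace (↥(maximalRealSubfield L)) L (IsCMField.complexConj L) 3 H v)) htop⟩
  · -- NON-SPLIT place: RIGf (dictionary form) inlined over the token D7αᵀ (PKΠ v1.15 `stub_RIGfDict`)
    push Not at hs
    letI : ∀ v : HeightOneSpectrum (𝓞 ↥(maximalRealSubfield L)), MeasurableSpace ((cmDatum L 3 H).Local v) := fun _ => borel _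
    letI : ∀ v : HeightOneSpectrum (𝓞 ↥(maximalRealSubfield L)),
        MeasurableSpace ((cmDatum L 2 (Matrix.of fun i j : Fin 2 => if i.val + j.val + 1 = 2 then (1 : L) else 0)).Local v ×
          (cmDatum L 1 (Matrix.of fun i j : Fin 1 => if i.val + j.val + 1 = 1 then (1 : L) else 0)).Local v) := fun _ => borel _
    letI : ∀ (v : HeightOneSpectrum (𝓞 ↥(maximalRealSubfield L)))
        (a : ((cmDatum L 2 (Matrix.of fun i j : Fin 2 => if i.val + j.val + 1 = 2 then (1 : L) else 0)).Local v ×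
          (cmDatum L 1 (Matrix.of fun i j : Fin 1 => if i.val + j.val + 1 = 1 then (1 : L) else 0)).Local v)),
        MeasurableSpace (((cmDatum L 2 (Matrix.of fun i j : Fin 2 => if i.val + j.val + 1 = 2 then (1 : L) else 0)).Local v ×
            (cmDatum L 1 (Matrix.of fun i j : Fin 1 => if i.val + j.val + 1 = 1 then (1 : L) else 0)).Local v) ⧸
          Subgroup.centralizer ({a} : Set ((cmDatum L 2 (Matrix.of fun i j : Fin 2 => if i.val + j.val + 1 = 2 then (1 : L) else 0)).Local v ×
            (cmDatum L 1 (Matrix.of fun i j : Fin 1 => if i.val + j.val + 1 = 1 then (1 : L) else 0)).Local v))) := fun _ _ => borel _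
    letI : ∀ (v : HeightOneSpectrum (𝓞 ↥(maximalRealSubfield L))) (γ : (cmDatum L 3 H).Local v),
        MeasurableSpace ((cmDatum L 3 H).Local v ⧸ Subgroup.centralizer ({γ} : Set ((cmDatum L 3 H).Local v))) := fun _ _ => borel _
    letI : ∀ v : HeightOneSpectrum (𝓞 ↥(maximalRealSubfield L)), MeasurableSpace (Gqs L v ⧸ Subgroup.center (Gqs L v)) := fun _ => borel _
    haveI : BorelSpace (Gqs L v ⧸ Subgroup.center (Gqs L v)) := ⟨rfl⟩
    obtain ⟨Δ, mH, mG, νG, νH, ξloc, μZ, packFin, hHaar, -, hDock, hShape, hMemRec⟩ := hD7αT L ι H T hT hdef h2 μω hμu hquad μ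
    haveI : (μZ v).IsHaarMeasure := hHaar v
    obtain ⟨Tm, a₀, ha₀, h₀, π2, πn, πs, hK, hs2, hn, hsc, hne', hId, hpack⟩ := hShape ξ v hs
    obtain ⟨ε, hε⟩ := F0P2oIsoAtXfOfThetaTypeAt.exists_isoAtXfCM_of_forall_mem L H e₁ dV hdV hdV0 g hg σ
      (F0P2iGRDWitness.grdMu L ξ μω hμu) hμ1 (F0P2iGRDWitness.grdChi L ξ μω hquad) hirr hadm v _
      (fun c hcst => hMemRec W σ hirr hsm hadm P hP hfin ξ hmem v hs c hcst)
      (fun c hmemc => F0P2oD7alphaMembersThetaClassTest.d7alpha_packet_members_thetaClassTest L H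
        (transpose_map_cmConjRingHom_eq_of_frame L ι H T hT) (isUnit_det_of_frame L ι H T hT) μω hμu Δ mH mG νG νH ξloc
        h75 e₁ dV hdV hdV0 g hg ξ (hDock e₁ dV hdV hdV0 g hg ξ) hquad (F0P2iGRDWitness.grdMu L ξ μω hμu) hμ1
        (F0P2iGRDWitness.grdChi L ξ μω hquad) hcont hunit
        (F0P2iGRDWitness.semilocalComponent_toHeckeCharacter_grdMu L ξ μω hμu)
        (F0P2iGRDWitness.grdChi_finAdelicCheck L ξ μω hquad (complexConj_mul_complexConj' L)) v hs (μZ v)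
        Tm a₀ ha₀ h₀ π2 πn hK hs2 hn πs hsc hne' hId c (by rw [hpack] at hmemc; exact hmemc))
    exact ⟨ε, (F0P2iVocabularyBridge.isoAtXf_iff_CM L H e₁ dV hdV hdV0 g hg σ (F0P2iGRDWitness.grdMu L ξ μω hμu) hμ1
      (F0P2iGRDWitness.grdChi L ξ μω hquad) ε v).mpr hε⟩

end Summit.HodgeConjecture.HodgeConjecture.Cruxes.H413.F0P2vPKPiOfTokens

end
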